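import Summits.FinalStateConjecture.FinalStateConjecture.Theses.LapseTrumpetKID

/-!
# `MaximalCensorship` (stmt-FinalStateConjecture-17998, ex 10158; route LapseTrumpetKID) — negative side:
# the generic crux as typed is false on every admissible non-PSC topology

The generic crux `MaximalCensorship` of route `LapseTrumpetKID` is quantified over EVERY connected,
Hausdorff, second countable smooth `3`-manifold `X` (it inherits the summit's `∀ X`), and its
property `P` demands that every MGHD of the datum carry a foliation `F : ℝ × X → M` each of whose
leaves `F(t, ·) : X → M` is a smooth embedded Cauchy hypersurface whose induced data `(h, k)` form
a MAXIMAL (`tr k = 0`), complete, asymptotically flat (order `1`), one-ended initial data set on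
`X` itself (clause (ii)).

Isenberg–Mazzeo–Pollack, *On the topology of vacuum spacetimes*, Ann. Henri Poincaré 4 (2003)
369–383 = arXiv:gr-qc/0206034, prove:

* Thm. 1 (p. 3): "Let `Σ` be any closed `n`-dimensional manifold, and `p ∈ Σ` arbitrary. Then
  `Σ ∖ {p}` admits an asymptotically Euclidean initial data set satisfying the vacuum constraint
  equations."
* Thm. 4 (p. 10) with Remark 2: if `Σ` admits no metric of positive scalar curvature (e.g. `T³`,
  any closed hyperbolic `3`-manifold), the maximal development of such data contains "no maximal
  (`τ = 0`) asymptotically Euclidean Cauchy surface" with induced metric decaying at a rate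
  `ν > 1/2` and `L¹` scalar curvature — the proof uses only: vacuum + `tr k = 0` ⇒
  `R(h) = |k|² ≥ 0` (Gauss equation), and an asymptotically Euclidean metric with `R ≥ 0` on
  `Σ ∖ {p}` conformally compactifies to a PSC metric on `Σ` (Schoen–Yau).

A leaf demanded by clause (ii) is exactly such a surface (order-`1` decay gives `ν = 1 > 1/2` and
`R = |k|² = O(r⁻⁴) ∈ L¹`; its topology is `X = Σ ∖ {p}` by construction). Hence on
`X = Σ ∖ {p}`, `Σ` closed non-PSC, the property `P` fails for EVERY admissible datum, while the
admissible class is non-empty (Thm. 1; the Dafermos–Rodnianski decay class of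
`admissibleVacuumData` is met after a centre-of-mass normalisation / exterior Kerr gluing,
Corvino–Schoen, J. Diff. Geom. 73 (2006), Thm. 1). A Christodoulou-generic property over a
non-empty admissible class must hold at the `c ≠ 0` members of an admissible family through any
exceptional datum — contradiction. So `MaximalCensorship` is FALSE AS TYPED (verdict: misstated —
the maximal-gauge mechanism is untouched on `X ≅ ℝ³`; repair: guard clause (ii) by the topology,
e.g. hypothesis "`X` carries a maximal admissible datum", and file the complementary topologies as
a separate item, or free the leaf topology from `X`).

This file isolates the argument as pure logic over the filed text (route-review refuter
`refuter-rreview1-FinalStateConjecture-LapseTrum-731f1007-0`, 2026-08-16, against item 10158 and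
the topology-free genericity `IsChristodoulouGeneric`). The route-repair of 2026-08-16T23:47Z
(Statement re-type T2) restated the crux as item stmt-FinalStateConjecture-17998 with TAME
genericity `InitialDataSet.IsTameChristodoulouGeneric … 1` and left the `∀ X` clause (ii)
untouched, so the counterexample stands verbatim; the proof is re-done over the tame notion (a tame
admissible family through an exceptional datum is still a family of admissible, hence exceptional,
data) and factored through the per-manifold statement `maximalCensorship_false_of_obstructed`
(crux-attack refuter `refuter-rattack-stmt-FinalStateConjecture-17998-0`, 2026-08-17; the
hypothesis `NonPSCAdmissibleTopology` is unchanged):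

* `maximalCensorship_false_of_obstructed` — for ANY data manifold `X` with non-empty admissible
  class on which no vacuum Cauchy development of an admissible datum contains such a maximal leaf,
  `¬ MaximalCensorship` (the shape of the planner's repair: clause (ii) must be guarded per `X`).

* `NonPSCAdmissibleTopology` — the construction hypothesis `H` of the negative-modulo lane: there
  is a data manifold `X` with non-empty admissible class such that NO vacuum Cauchy development of
  an admissible datum on `X` contains a smoothly embedded Cauchy hypersurface `f : X → M` with
  future unit normal whose induced data are maximal, complete and asymptotically flat of order `1`
  at a sole end. TRUE in print (IMP 2003, Thm. 1 + Thm. 4, `X = T³ ∖ {p}`); not constructible in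
  the tree today (no connected-sum manifolds over `E3`, no conformal-method existence theory, no
  PSC obstruction).
* `maximalCensorship_false_of_nonPSCAdmissibleTopology` —
  `NonPSCAdmissibleTopology → ¬ MaximalCensorship`.

## References

* J. Isenberg, R. Mazzeo, D. Pollack, *On the topology of vacuum spacetimes*, Ann. Henri Poincaré
  4 (2003) 369–383, arXiv:gr-qc/0206034, Thm. 1 (p. 3), Thm. 4 and Remark 2 (p. 10).
* R. Schoen, S.-T. Yau, *On the structure of manifolds with positive scalar curvature*,
  Manuscripta Math. 28 (1979) 159–183 (no PSC on `T³`).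
* J. Corvino, R. Schoen, *On the asymptotics for the vacuum Einstein constraint equations*,
  J. Differential Geom. 73 (2006) 185–217, Thm. 1 (exterior Kerr gluing).
* D. Christodoulou, Class. Quantum Grav. 16 (1999) A23–A35, p. A24 (genericity by codimension).
* D. M. Witt, *Vacuum space-times that admit no maximal slice*, Phys. Rev. Lett. 57 (1986)
  1386–1389 (the first vacuum no-maximal-slice examples).
-/

noncomputable section

-- D-0017: single-problem summit, `Summit.<S>.<S>.…` by design (cf. lakefile `weak.linter.dupNamespace`).
set_option linter.dupNamespace false

open Set Filter
open scoped Manifold ContDiff Topology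

namespace Summit.FinalStateConjecture.FinalStateConjecture.Theorems.MaximalCensorship.Negative

open Literature.Geometry.Lorentzian
open Summit.FinalStateConjecture.FinalStateConjecture.Theses.LapseTrumpetKID (MaximalCensorship)

/-- **Construction hypothesis `H` (an admissible non-PSC topology).** There is a connected,
Hausdorff, second countable smooth `3`-manifold `X` whose admissible class
`admissibleVacuumData X` is non-empty and such that no vacuum Cauchy development `𝒟` of an
admissible datum on `X` contains a smoothly embedded Cauchy hypersurface `f : X → 𝒟.carrier`
with a future unit normal `νf` whose induced metric and second fundamental form agree with an
initial data set `Dt` on `X` that is maximal (`tr k = 0`), complete, and asymptotically flat of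
order `1` at an end which is the sole end of `X`. Holds for `X = Σ ∖ {p}` with `Σ` a closed
`3`-manifold carrying no metric of positive scalar curvature (`Σ = T³`, closed hyperbolic `Σ`):
Isenberg–Mazzeo–Pollack, Ann. Henri Poincaré 4 (2003) 369, Thm. 1 (admissible data exist on
`Σ ∖ {p}`) and Thm. 4 with Remark 2 (vacuum + maximal ⇒ `R(h) = |k|² ≥ 0`; an asymptotically
Euclidean `R ≥ 0` metric on `Σ ∖ {p}` compactifies to a PSC metric on `Σ`, Schoen–Yau 1979;
references.bib keys IsenbergMazzeoPollack2002, CorvinoSchoen2006 for the decay-class upgrade);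
NOT constructed in the tree (no connected-sum `3`-manifolds over `E3`, no conformal-method
existence theory, no PSC obstruction) — the construction hypothesis `H` of the negative-modulo
lane, expected TRUE. -/
def NonPSCAdmissibleTopology : Prop :=
  ∃ (X : Type) (_ : TopologicalSpace X) (_ : ChartedSpace E3 X)
    (_ : IsManifold (𝓡 3) ((⊤ : ℕ∞) : WithTop ℕ∞) X) (_ : T2Space X)
    (_ : SecondCountableTopology X) (_ : ConnectedSpace X),
    (admissibleVacuumData X).Nonempty ∧
    ∀ D ∈ admissibleVacuumData X, ∀ (𝒟 : VacuumCauchyDevelopment D) (f : X → 𝒟.carrier)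
      (νf : NormalField (𝓡 4) f),
      Manifold.IsSmoothEmbedding (𝓡 3) (𝓡 4) ((⊤ : ℕ∞) : WithTop ℕ∞) f →
      𝒟.metric.IsCauchyHypersurface 𝒟.timeOrientation (range f) →
      𝒟.metric.IsFutureUnitNormal (𝓡 3) 𝒟.timeOrientation f νf →
      ∀ Dt : InitialDataSet (𝓡 3) X,
        (∀ (x : X) (v w : TangentSpace (𝓡 3) x), Dt.h.inner x v w =
            𝒟.metric.val (f x) (mfderiv (𝓡 3) (𝓡 4) f x v) (mfderiv (𝓡 3) (𝓡 4) f x w)) →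
        (∀ [𝒟.metric.toPseudoRiemannianMetric.HasLeviCivita] (x : X),
            𝒟.metric.toPseudoRiemannianMetric.secondFundamentalForm (𝓡 3) f νf x = Dt.kBilin x) →
        Dt.IsMaximalData → (∀ [Dt.metric.HasLeviCivita], Dt.IsComplete) →
        ∀ e : AFEnd X, e.IsSoleEnd → ¬ e.IsAsymptoticallyFlat Dt 1

/-- **`MaximalCensorship` fails on any topologically obstructed data manifold.** Let `X` carry an
admissible datum, and suppose that no vacuum Cauchy development of an admissible datum on `X`
contains a smoothly embedded Cauchy hypersurface `f : X → M` with a future unit normal whose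
induced metric and second fundamental form agree with a maximal, complete initial data set on `X`,
asymptotically flat of order `1` at a sole end (the body of `NonPSCAdmissibleTopology` at `X`;
verbatim the per-leaf clause (ii) of the crux). Then the crux property fails for EVERY admissible
datum on `X` — its first conjunct supplies an MGHD `𝒟`, its second a foliation `F` of `𝒟` whose
leaf `x ↦ F (0, x)` would be a forbidden maximal leaf — while tame Christodoulou genericity
(`IsTameChristodoulouGeneric 𝓓 P 1`) over the non-empty class `𝓓 = admissibleVacuumData X`
requires `P` at the parameter-`c ≠ 0` members of a tame ADMISSIBLE family through the exceptional
datum: contradiction. At `X = Σ ∖ {p}`, `Σ` closed non-PSC, both hypotheses are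
Isenberg–Mazzeo–Pollack 2003, Thm. 1 and Thm. 4 (Witt, PRL 57 (1986) 1386).
[cite: IsenbergMazzeoPollack2002, Thm. 1 (p. 3), Thm. 4 (p. 10)] [cite: Witt1986] -/
theorem maximalCensorship_false_of_obstructed (X : Type) [TopologicalSpace X] [ChartedSpace E3 X]
    [IsManifold (𝓡 3) ((⊤ : ℕ∞) : WithTop ℕ∞) X] [T2Space X] [SecondCountableTopology X]
    [ConnectedSpace X] (hne : (admissibleVacuumData X).Nonempty)
    (hno : ∀ D ∈ admissibleVacuumData X, ∀ (𝒟 : VacuumCauchyDevelopment D) (f : X → 𝒟.carrier)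
      (νf : NormalField (𝓡 4) f),
      Manifold.IsSmoothEmbedding (𝓡 3) (𝓡 4) ((⊤ : ℕ∞) : WithTop ℕ∞) f →
      𝒟.metric.IsCauchyHypersurface 𝒟.timeOrientation (range f) →
      𝒟.metric.IsFutureUnitNormal (𝓡 3) 𝒟.timeOrientation f νf →
      ∀ Dt : InitialDataSet (𝓡 3) X,
        (∀ (x : X) (v w : TangentSpace (𝓡 3) x), Dt.h.inner x v w =
            𝒟.metric.val (f x) (mfderiv (𝓡 3) (𝓡 4) f x v) (mfderiv (𝓡 3) (𝓡 4) f x w)) →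
        (∀ [𝒟.metric.toPseudoRiemannianMetric.HasLeviCivita] (x : X),
            𝒟.metric.toPseudoRiemannianMetric.secondFundamentalForm (𝓡 3) f νf x = Dt.kBilin x) →
        Dt.IsMaximalData → (∀ [Dt.metric.HasLeviCivita], Dt.IsComplete) →
        ∀ e : AFEnd X, e.IsSoleEnd → ¬ e.IsAsymptoticallyFlat Dt 1) :
    ¬ MaximalCensorship := by
  rintro hMC
  obtain ⟨D₀, hD₀⟩ := hne
  -- the crux's property, read off `hMC X`, fails for every admissible datum on `X`
  obtain ⟨P, hP, hgen⟩ : ∃ P : InitialDataSet (𝓡 3) X → Prop,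
      (∀ D ∈ admissibleVacuumData X, ¬ P D) ∧
        InitialDataSet.IsTameChristodoulouGeneric (admissibleVacuumData X) P 1 := by
    refine ⟨_, ?_, hMC X⟩
    rintro D hD ⟨⟨𝒟, hmax⟩, hall⟩
    obtain ⟨-, F, ν, ⟨-, hEmb, hCauchy, hNormal, hData, -, -⟩, -⟩ := hall 𝒟 hmax
    obtain ⟨Dt, hh, hk, hmaxl, hcompl, e, hsole, hAF⟩ := hData 0
    exact hno D hD 𝒟 (fun x ↦ F (0, x)) (ν 0) (hEmb 0) (hCauchy 0) (hNormal 0) Dt hh hk hmaxl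
      hcompl e hsole hAF
  -- a tame admissible family through the exceptional datum `D₀` must leave the exceptional set
  obtain ⟨e, Fam, -, -, -, -, hF𝓓, hFE⟩ := hgen D₀ ⟨hD₀, hP D₀ hD₀⟩
  obtain ⟨c, hc⟩ := exists_ne (0 : EuclideanSpace ℝ (Fin 1))
  exact hFE c hc ⟨hF𝓓 c, hP (Fam c) (hF𝓓 c)⟩

/-- **The generic crux as typed is false modulo an admissible non-PSC topology.** Under
`NonPSCAdmissibleTopology` (Isenberg–Mazzeo–Pollack 2003, Thm. 1 + Thm. 4 for `X = T³ ∖ {p}`)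
the property of item stmt-FinalStateConjecture-17998 (ex 10158) fails for EVERY admissible datum
on the witness manifold `X` (clause (ii) at the leaf `t = 0` of any MGHD would be a forbidden
maximal leaf), the admissible class of `X` is non-empty, and a tame-Christodoulou-generic property
(`IsTameChristodoulouGeneric 𝓓 P 1`) must hold at the parameter-`c ≠ 0` members of a tame
admissible one-parameter family through an exceptional datum — contradiction
(`maximalCensorship_false_of_obstructed`). Verdict MISSTATED: the witness exploits the unguarded
`∀ X`; on `X ≅ ℝ³` nothing is said. Minimal repair `C′` (refuter's reading): guard the generic
clause per `X` by "`X` carries a complete maximal asymptotically flat vacuum datum" —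
`(∃ D₀ : InitialDataSet (𝓡 3) X, (∀ [D₀.metric.HasLeviCivita], D₀.IsVacuumConstraintSolution ∧
D₀.IsComplete) ∧ D₀.IsMaximalData ∧ ∃ e : AFEnd X, e.IsSoleEnd ∧ e.IsAsymptoticallyFlat D₀ 1) →`
(by IMP Thm. 4 exactly the PSC-compatible `X ≅ ℝ³ # …`; `ℝ³` qualifies through `trivialData`) —
or fix `X := Minkowski.slice`; the witness misses `C′`. [folklore] -/
theorem maximalCensorship_false_of_nonPSCAdmissibleTopology :
    NonPSCAdmissibleTopology → ¬ MaximalCensorship := by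
  rintro ⟨X, _, _, _, _, _, _, hne, hno⟩
  exact maximalCensorship_false_of_obstructed X hne hno

end Summit.FinalStateConjecture.FinalStateConjecture.Theorems.MaximalCensorship.Negative

end
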